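import Summits.BirchSwinnertonDyer.BirchSwinnertonDyer.Theorems.KolyvaginRankRigidityAtTwoRegularRefillAtKolyvaginPlace
import Summits.BirchSwinnertonDyer.BirchSwinnertonDyer.Theorems.Rank1ResidualJetSelmerLemmas
import Summits.BirchSwinnertonDyer.Rank1Residual.X5.TransverseRelaxedStrictCount
import Summits.BirchSwinnertonDyer.Rank1Residual.GaloisImage.LocalH1TorsionBounded
import Summits.BirchSwinnertonDyer.Rank1Residual.GaloisImage.LocalEulerPoincareCharacteristicHolds
import HarnessLib

/-!
# Crux U1 `KolyvaginBoundedDefectAtTwo` (stmt-BirchSwinnertonDyer-28083), LINE 17 `regular_core_rigidity` v3,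
# stub S1b `stub_nearCoreExistenceAtTwo` — the REFILL LAW for Jetchev's modified structure `𝓕(c)` at `2`:
# the second global input (`#loc_v H¹_{𝓕(c)^v} = #Kum_v`, Poitou–Tate counting) and the assembled law

Width seat `bsd-line-krr2-p2` g13 (ONE READER on S1b, re-key (280)(c)); `--supports stmt-BirchSwinnertonDyer-28083`
(helper). THEOREMS ONLY: nothing here proves S1b, U1, a rung or BSD. BSD is NOT proved.

## What

`𝓛 = 𝓕(c) := selmerF W 2^M 𝒯 (placesDividing K c)` is Jetchev's modified Selmer structure (transverse `𝒯_w` at the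
places of the square-free Kolyvagin conductor `c`, all indices `≥ M + 1`; Kummer elsewhere; its Selmer group is the
tree's `Jetchev2008.modifiedSelmerGroup` by `JET.SelmerVocabulary.selmerGroup_selmerF_eq_modifiedSelmerGroup`). At a
place `v` of `c`, `𝓛[v ↦ ⊤]` / `𝓛[v ↦ ⊥]` are `𝓕(c)` relaxed / strict at `v` (`Function.update`, no definition), and
`X := loc_v(H¹_{𝓛[v ↦ ⊤]}) ≤ H¹(K_v, E[2^M])`. Then:
* `natCard_map_localization_relaxed_selmerF_eq` — **`#X = #Kum_v`**: `[H¹_{𝓛^v} : H¹_{𝓛_v}] = #E(K_v)[2^M] · #(𝓞_v/2^M)`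
  by `X5.TransverseCount.relIndex_update_bot_update_top_eq_of_eq_kummer_off` (Poitou–Tate counting for a structure
  that is Kummer off `placesDividing K c` and self-dual on it — the LEAD's Lagrangian theorem at `2`, margin one;
  Tate's local Euler characteristic `localEulerPoincareCharacteristic_holds`; no real place since `K` is imaginary
  quadratic), `#(𝓞_v/2^M) = 1` (`v ∤ 2`), `#Kum_v = #E(K_v)[2^M]`, and `[H¹_{𝓛^v} : H¹_{𝓛_v}] = #loc_v(H¹_{𝓛^v})`;
* `isotropic_map_localization_relaxed_selmerF` — `X` is isotropic (file `…RegularRefillAtKolyvaginPlace` §4);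
* `two_nsmul_mem_map_localization_relaxed_selmerF` / `natCard_kummer_le_two_mul_relaxed_selmerF` — **THE REFILL
  LAW FOR `𝓕(c)`**: if the Kummer cut `X ∩ Kum_v = loc_v(H¹_{𝓕(c/ℓ)…})` is co-cyclic (`Kum_v = (X ∩ Kum_v) + ℤe₀`; at a
  REGULAR `ℓ`: the pure-sign cut), then `2 · ann_{𝒯_v}(X ∩ Kum_v) ⊆ X` and
  `#Kum_v ≤ 2 · #(X ∩ Kum_v) · #(X ∩ 𝒯_v)` — the refill `X ∩ 𝒯_v = loc_v(H¹_{𝓕(c)})` has exponent `a ≥ M − 1`.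
  The only hypotheses left are the frame (`K` imaginary quadratic, `d_K < −4`, Weil datum `e` on `E[2^M]`, a
  Poitou–Tate family `inv` with `IsPerfect ∧ SumLocalTermEqZero ∧ SelmerComplement` — the tree's PROVED
  `poitouTate_selmerStructure_duality_conj_holds` supplies one) and the co-cyclicity of the cut;
* `lozenge_refill_selmerF` — WALK FORM: `#H¹_{𝓛[v ↦ Kum_v]} · #Kum_v ≤ 2 · #loc_v(H¹_{𝓛[v ↦ Kum_v]})² · #H¹_{𝓛}`, i.e. at a
  regular pure-sign step `#H¹_{𝓕(c)} ≥ #H¹_{𝓕(c/ℓ)} / 2` (`selmerGroup_update_eq_inf_comap` reads both vertices off the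
  `v`-relaxed group).
References (locators only; no cited FACT is declared): [cite: MazurRubin2004, Lemma 1.2.4, Prop. 1.3.2, Thm. 2.3.4,
§4.1] [cite: Howard2004HeegnerKolyvagin, Thm. 2.1.11] [cite: Jetchev2008, §3.4.1, Thm. 5.1, Lemma 5.2 (iii)]
[cite: MilneADT2006, Ch. I, Cor. 2.3, Thm. 2.8, Thm. 4.10 (b)] [cite: Sakamoto2024, §3.1.2, Def. 3.9].
Design: no definitions; `K : Type`; axioms `propext`, `Classical.choice`, `Quot.sound`.
-/

set_option autoImplicit false
-- the Theorems namespace of this sub repeats the summit name by design (D-0017 nested layout)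
set_option linter.dupNamespace false

noncomputable section

open scoped Classical
open Function NumberField IsDedekindDomain WeierstrassCurve Field
open Literature.NumberTheory.EllipticCurves Literature.NumberTheory.EllipticCurves.Jetchev2008
open Literature.NumberTheory.GaloisRepresentations Literature.NumberTheory.GaloisCohomology
open Literature.NumberTheory.GaloisRepresentations.DiscreteGaloisModule (localTatePairingZMod tateDual
  transverseSubgroup SelmerStructure)
open Literature.NumberTheory.Automorphic
open Summit.BirchSwinnertonDyer.Rank1Residual
open Summit.BirchSwinnertonDyer.Rank1Residual.JET.RingClassTransverse
open Summit.BirchSwinnertonDyer.Rank1Residual.JET.SelmerVocabulary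
open Summit.BirchSwinnertonDyer.Rank1Residual.X11b.Relaxation (invWeilPairing invWeilPairing_apply
  invWeilPairing_eq_zero_of_mem)
open Summit.BirchSwinnertonDyer.BirchSwinnertonDyer.Theorems.KolyvaginLowerBoundAtTwo

namespace Summit.BirchSwinnertonDyer.BirchSwinnertonDyer.Theorems.KolyvaginAtTwo.RegularRefill

-- cup products need the compactness of the local absolute Galois groups (as in the tree's cup-product files)
attribute [local instance] absoluteGaloisGroup_compactSpace

variable {K : Type} [Field K] [NumberField K] (W : WeierstrassCurve ℚ) [W.IsElliptic] [W.IsGloballyMinimal]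
  (M : ℕ)
  (e : geomTorsion (W.baseChange K) ((2 ^ M : ℕ) : ℤ) → geomTorsion (W.baseChange K) ((2 ^ M : ℕ) : ℤ) →
    AlgebraicClosure K)
  (hμ : ∀ S T, e S T ^ (2 ^ M) = 1)
  (hadd₁ : ∀ S₁ S₂ T, e (S₁ + S₂) T = e S₁ T * e S₂ T)
  (hadd₂ : ∀ S T₁ T₂, e S (T₁ + T₂) = e S T₁ * e S T₂)
  (hgal : ∀ (g : absoluteGaloisGroup K) (S T : geomTorsion (W.baseChange K) ((2 ^ M : ℕ) : ℤ)),
    g • e S T = e (g • S) (g • T))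
  (halt : ∀ T, e T T = 1) (hnondeg : ∀ T, (∀ S, e S T = 1) → T = 0)
  (inv : LocalInvariants K (2 ^ M))
  (hK : IsImaginaryQuadratic K) (hD : NumberField.discr K < -4) (ι : K →+* ℂ)
  [∀ j : ℕ, NumberField (ringClassField K ι j)] (hM : 1 ≤ M)
  (c : ℕ) (hc : Squarefree c)
  (hkol : ∀ ℓ ∈ c.primeFactors, Zhang2014.IsKolyvaginPrime (W.conductorNorm ℤ) W K 2 ℓ)
  (hkM : ∀ ℓ ∈ c.primeFactors, M + 1 ≤ Zhang2014.kolyvaginIndex W 2 ℓ)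
  (𝒯 : SelmerStructure ((W.baseChange K).torsionGaloisModule ((2 ^ M : ℕ) : ℤ)))
  (h𝒯 : ∀ v : HeightOneSpectrum (𝓞 K), 𝒯 (Sum.inr v) =
    ⨅ ℓ ∈ c.primeFactors.filter (fun ℓ : ℕ ↦ ((ℓ : ℕ) : 𝓞 K) ∈ v.asIdeal),
      ⨅ (w' : HeightOneSpectrum (𝓞 (ringClassField K ι ℓ))) (_ : w'.asIdeal.LiesOver v.asIdeal),
        letI := (adicCompletionOfLiesOver K (ringClassField K ι ℓ) v w').toAlgebra
        transverseSubgroup (GaloisRep.toLocal v ((W.baseChange K).torsionGaloisModule ((2 ^ M : ℕ) : ℤ)))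
          (w'.adicCompletion (ringClassField K ι ℓ)))
  (hperf : inv.IsPerfect) (hvan : inv.SumLocalTermEqZero) (hcomp : inv.SelmerComplement)
  (v : HeightOneSpectrum (𝓞 K)) (hvc : v ∈ placesDividing K c)

/-! ### §1 `H¹_{𝓛[v ↦ D]} = H¹_{𝓛[v ↦ ⊤]} ∩ loc_v⁻¹(D)`; the relaxed/strict index is the order of the image -/

omit [W.IsElliptic] [W.IsGloballyMinimal] in
/-- For any Selmer structure `𝓛`, finite place `v` and local condition `D` at `v`:
`H¹_{𝓛[v ↦ D]} = H¹_{𝓛[v ↦ ⊤]} ∩ loc_v⁻¹(D)`. [folklore] -/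
theorem selmerGroup_update_eq_inf_comap (𝓛 : SelmerStructure ((W.baseChange K).torsionGaloisModule ((2 ^ M : ℕ) : ℤ)))
    (v : HeightOneSpectrum (𝓞 K))
    (D : AddSubgroup (galoisCohomology ((((W.baseChange K).torsionGaloisModule ((2 ^ M : ℕ) : ℤ))).toLocal
      (Sum.inr v : Place K)) 1)) :
    SelmerStructure.selmerGroup (Function.update 𝓛 (Sum.inr v : Place K) D :
        SelmerStructure ((W.baseChange K).torsionGaloisModule ((2 ^ M : ℕ) : ℤ))) =
      SelmerStructure.selmerGroup (Function.update 𝓛 (Sum.inr v : Place K) ⊤ :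
        SelmerStructure ((W.baseChange K).torsionGaloisModule ((2 ^ M : ℕ) : ℤ))) ⊓
      D.comap (galoisCohomology.localization ((W.baseChange K).torsionGaloisModule ((2 ^ M : ℕ) : ℤ))
        (Sum.inr v : Place K) 1) := by
  ext x
  simp only [AddSubgroup.mem_inf, AddSubgroup.mem_comap, SelmerStructure.mem_selmerGroup_iff]
  constructor
  · intro h
    refine ⟨fun w ↦ ?_, ?_⟩
    · by_cases hw : w = Sum.inr v
      · subst hw; rw [Function.update_self]; exact AddSubgroup.mem_top _
      · rw [Function.update_of_ne hw]
        have h' := h w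
        rwa [Function.update_of_ne hw] at h'
    · have h' := h (Sum.inr v)
      rwa [Function.update_self] at h'
  · rintro ⟨h, hD⟩ w
    by_cases hw : w = Sum.inr v
    · subst hw; rwa [Function.update_self]
    · rw [Function.update_of_ne hw]
      have h' := h w
      rwa [Function.update_of_ne hw] at h'

omit [W.IsElliptic] [W.IsGloballyMinimal] in
/-- `[H¹_{𝓛[v ↦ ⊤]} : H¹_{𝓛[v ↦ ⊥]}] = #loc_v(H¹_{𝓛[v ↦ ⊤]})` (no global finiteness needed). [folklore] -/
theorem relIndex_update_bot_top_eq_natCard_map (𝓛 : SelmerStructure ((W.baseChange K).torsionGaloisModule ((2 ^ M : ℕ) : ℤ)))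
    (v : HeightOneSpectrum (𝓞 K)) :
    (SelmerStructure.selmerGroup (Function.update 𝓛 (Sum.inr v : Place K) ⊥ :
        SelmerStructure ((W.baseChange K).torsionGaloisModule ((2 ^ M : ℕ) : ℤ)))).relIndex
      (SelmerStructure.selmerGroup (Function.update 𝓛 (Sum.inr v : Place K) ⊤ :
        SelmerStructure ((W.baseChange K).torsionGaloisModule ((2 ^ M : ℕ) : ℤ)))) =
      Nat.card ((SelmerStructure.selmerGroup (Function.update 𝓛 (Sum.inr v : Place K) ⊤ :
          SelmerStructure ((W.baseChange K).torsionGaloisModule ((2 ^ M : ℕ) : ℤ)))).map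
        (galoisCohomology.localization ((W.baseChange K).torsionGaloisModule ((2 ^ M : ℕ) : ℤ))
          (Sum.inr v : Place K) 1)) := by
  rw [selmerGroup_update_eq_inf_comap W M 𝓛 v ⊥, AddMonoidHom.comap_bot, inf_comm, AddSubgroup.inf_relIndex_right,
    AddSubgroup.relIndex_ker]

/-! ### §2 The count `#loc_v(H¹_{𝓕(c)^v}) = #Kum_v` -/

include hμ hadd₁ hadd₂ hgal hK hD hM hc hkol hkM h𝒯 halt hnondeg hperf hvan hcomp hvc in
/-- **`#loc_v(H¹_{𝓕(c)^v}) = #Kum_v`** at a place `v` of the square-free Kolyvagin conductor `c` (indices `≥ M + 1`),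
for Jetchev's modified structure `𝓕(c) = selmerF W 2^M 𝒯 (placesDividing K c)` relaxed at `v`: Poitou–Tate counting
(`X5.TransverseCount.relIndex_update_bot_update_top_eq_of_eq_kummer_off`) for a structure Kummer off `placesDividing K c`
and self-dual on it (`dualTransported_eq_of_localTransverseFamily_two`), Tate's local Euler characteristic
(`localEulerPoincareCharacteristic_holds`), `#(𝓞_v/2^M) = 1`, `#Kum_v = #E(K_v)[2^M]`.
[cite: Howard2004HeegnerKolyvagin, Thm. 2.1.11] [cite: MilneADT2006, Ch. I, Thm. 2.8, Thm. 4.10 (b)]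
[cite: Jetchev2008, Lemma 5.2 (iii)] -/
theorem natCard_map_localization_relaxed_selmerF_eq [NeZero (2 ^ M)]
    [Finite (geomTorsion (W.baseChange K) ((2 ^ M : ℕ) : ℤ))] :
    Nat.card ((SelmerStructure.selmerGroup (Function.update (selmerF W ((2 ^ M : ℕ) : ℤ) 𝒯 (placesDividing K c))
          (Sum.inr v : Place K) ⊤ : SelmerStructure ((W.baseChange K).torsionGaloisModule ((2 ^ M : ℕ) : ℤ)))).map
        (galoisCohomology.localization ((W.baseChange K).torsionGaloisModule ((2 ^ M : ℕ) : ℤ))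
          (Sum.inr v : Place K) 1)) =
      Nat.card ((W.baseChange K).kummerSelmerStructure ((2 ^ M : ℕ) : ℤ) (Sum.inr v : Place K)) := by
  classical
  haveI : Fact (Nat.Prime 2) := ⟨Nat.prime_two⟩
  have hn : IsPrimePow (2 ^ M) := ⟨2, M, Nat.prime_two.prime, hM, rfl⟩
  have hc0 : c ≠ 0 := hc.ne_zero
  -- the Kolyvagin prime under `v`
  obtain ⟨ℓ₀, hℓ₀c, hℓ₀v⟩ := (natCast_mem_iff_exists_primeFactor_mem hc0 v).mp
    ((mem_placesDividing_iff_natCast_mem hc0 v).mp hvc)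
  have hℓ₀ := hkol ℓ₀ hℓ₀c
  have hpv : ((2 : ℕ) : 𝓞 K) ∉ v.asIdeal := by
    have h := (hasGoodReductionAt_of_zhangKolyvagin W K Nat.prime_two hℓ₀ v hℓ₀v 1).2
    rwa [pow_one, Int.cast_natCast] at h
  have hgood := (hasGoodReductionAt_of_zhangKolyvagin W K Nat.prime_two hℓ₀ v hℓ₀v 1).1
  have h2Mv : (((2 ^ M : ℕ) : ℕ) : 𝓞 K) ∉ v.asIdeal := by
    rw [Nat.cast_pow]
    exact fun h ↦ hpv (v.isPrime.mem_of_pow_mem M h)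
  -- inputs of the X5 count
  have hEP : ∀ w : HeightOneSpectrum (𝓞 K), localEulerPoincareCharacteristic (w.adicCompletion K) := fun w ↦ by
    haveI : CharZero (w.adicCompletion K) := charZero_adicCompletion w
    exact localEulerPoincareCharacteristic_holds (w.adicCompletion K)
  have hreal : ∀ w : InfinitePlace K, w.IsReal → Injective (inv (Sum.inl w)) := fun w hw ↦ by
    haveI : IsTotallyComplex K := hK.2
    exact absurd (IsTotallyComplex.isComplex w) (InfinitePlace.not_isComplex_iff_isReal.mpr hw)
  have hinl : ∀ w : InfinitePlace K, selmerF W ((2 ^ M : ℕ) : ℤ) 𝒯 (placesDividing K c) (Sum.inl w) =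
      (W.baseChange K).kummerSelmerStructure ((2 ^ M : ℕ) : ℤ) (Sum.inl w) := fun w ↦
    selmerF_inl W ((2 ^ M : ℕ) : ℤ) 𝒯 (placesDividing K c) w
  have hinr : ∀ q : HeightOneSpectrum (𝓞 K), q ∉ placesDividing K c →
      selmerF W ((2 ^ M : ℕ) : ℤ) 𝒯 (placesDividing K c) (Sum.inr q) =
        (W.baseChange K).kummerSelmerStructure ((2 ^ M : ℕ) : ℤ) (Sum.inr q) := fun q hq ↦ by
    rw [selmerF_inr, if_neg hq]
  have hon : ∀ q ∈ placesDividing K c,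
      inv.dualTransported (selmerF W ((2 ^ M : ℕ) : ℤ) 𝒯 (placesDividing K c))
          (weilDualIntertwining (W.baseChange K) (2 ^ M) e hμ hadd₁ hadd₂ hgal) (Sum.inr q) =
        selmerF W ((2 ^ M : ℕ) : ℤ) 𝒯 (placesDividing K c) (Sum.inr q) := fun q hq ↦ by
    have hq' : selmerF W ((2 ^ M : ℕ) : ℤ) 𝒯 (placesDividing K c) (Sum.inr q) = 𝒯 (Sum.inr q) := by
      rw [selmerF_inr, if_pos hq]
    rw [X5.TransverseCount.dualTransported_congr (W.baseChange K) (2 ^ M) e hμ hadd₁ hadd₂ hgal inv hq', hq']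
    exact dualTransported_eq_of_localTransverseFamily_two W K hK hD ι M hM c hc hkol hkM 𝒯 h𝒯 e hμ hadd₁ hadd₂
      hgal halt hnondeg inv hperf q hq
  have hcount := X5.TransverseCount.relIndex_update_bot_update_top_eq_of_eq_kummer_off (W.baseChange K) (2 ^ M)
    e hμ hadd₁ hadd₂ hgal halt hnondeg inv hn hperf hvan hcomp hEP hreal (placesDividing K c) hinl hinr hon v
  rw [relIndex_update_bot_top_eq_natCard_map W M,
    GaloisImage.natCard_quot_adicCompletionIntegers_eq_one_of_not_mem v h2Mv, mul_one] at hcount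
  rw [hcount, X11b.KummerPT.kummerSelmerStructure_inr_eq_unramifiedSubgroup (W.baseChange K) 2 M hpv hgood]
  exact (GaloisImage.LocalH1UnramifiedSquare.natCard_unramifiedSubgroup_torsion_adicCompletion_eq_of_ne_zero
    (W.baseChange K) v (NeZero.ne (2 ^ M))).symm

/-! ### §3 The image of the relaxed group is isotropic -/

include hK hD hM hc hkol hkM h𝒯 halt hnondeg hperf hvan hvc in
/-- **`loc_v(H¹_{𝓕(c)^v})` is isotropic for `inv_v(· ∪ₑ ·)`**: members of `H¹_{𝓕(c)^v}` satisfy the hybrid conditions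
off `v` (`selmerF_inr` / `selmerF_inl`), so `invWeilPairing_localization_eq_zero_of_hybrid_off` applies.
[cite: MilneADT2006, Ch. I, Thm. 4.10 (b)] -/
theorem isotropic_map_localization_relaxed_selmerF [NeZero (2 ^ M)]
    [Finite (geomTorsion (W.baseChange K) ((2 ^ M : ℕ) : ℤ))] :
    ∀ x ∈ (SelmerStructure.selmerGroup (Function.update (selmerF W ((2 ^ M : ℕ) : ℤ) 𝒯 (placesDividing K c))
          (Sum.inr v : Place K) ⊤ : SelmerStructure ((W.baseChange K).torsionGaloisModule ((2 ^ M : ℕ) : ℤ)))).map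
        (galoisCohomology.localization ((W.baseChange K).torsionGaloisModule ((2 ^ M : ℕ) : ℤ))
          (Sum.inr v : Place K) 1),
    ∀ y ∈ (SelmerStructure.selmerGroup (Function.update (selmerF W ((2 ^ M : ℕ) : ℤ) 𝒯 (placesDividing K c))
          (Sum.inr v : Place K) ⊤ : SelmerStructure ((W.baseChange K).torsionGaloisModule ((2 ^ M : ℕ) : ℤ)))).map
        (galoisCohomology.localization ((W.baseChange K).torsionGaloisModule ((2 ^ M : ℕ) : ℤ))
          (Sum.inr v : Place K) 1),
      invWeilPairing (W.baseChange K) (2 ^ M) e hμ hadd₁ hadd₂ hgal inv (Sum.inr v) x y = 0 := by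
  intro a ha b hb
  obtain ⟨x, hx, rfl⟩ := AddSubgroup.mem_map.mp ha
  obtain ⟨y, hy, rfl⟩ := AddSubgroup.mem_map.mp hb
  rw [SelmerStructure.mem_selmerGroup_iff] at hx hy
  -- read the hybrid conditions off `v`
  have hT : ∀ {z : galoisCohomology ((W.baseChange K).torsionGaloisModule ((2 ^ M : ℕ) : ℤ)) 1},
      (∀ w : Place K, galoisCohomology.localization ((W.baseChange K).torsionGaloisModule ((2 ^ M : ℕ) : ℤ)) w 1 z ∈
        Function.update (selmerF W ((2 ^ M : ℕ) : ℤ) 𝒯 (placesDividing K c)) (Sum.inr v : Place K) ⊤ w) →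
      ∀ w ∈ placesDividing K c, w ≠ v →
        galoisCohomology.localization ((W.baseChange K).torsionGaloisModule ((2 ^ M : ℕ) : ℤ)) (Sum.inr w) 1 z ∈
          𝒯 (Sum.inr w) := by
    intro z hz w hwc hwv
    have h := hz (Sum.inr w)
    rwa [Function.update_of_ne (fun h' ↦ hwv (Sum.inr_injective h')), selmerF_inr, if_pos hwc] at h
  have hKu : ∀ {z : galoisCohomology ((W.baseChange K).torsionGaloisModule ((2 ^ M : ℕ) : ℤ)) 1},
      (∀ w : Place K, galoisCohomology.localization ((W.baseChange K).torsionGaloisModule ((2 ^ M : ℕ) : ℤ)) w 1 z ∈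
        Function.update (selmerF W ((2 ^ M : ℕ) : ℤ) 𝒯 (placesDividing K c)) (Sum.inr v : Place K) ⊤ w) →
      ∀ w : HeightOneSpectrum (𝓞 K), w ∉ placesDividing K c →
        galoisCohomology.localization ((W.baseChange K).torsionGaloisModule ((2 ^ M : ℕ) : ℤ)) (Sum.inr w) 1 z ∈
          (W.baseChange K).kummerSelmerStructure ((2 ^ M : ℕ) : ℤ) (Sum.inr w) := by
    intro z hz w hwc
    have hwv : (Sum.inr w : Place K) ≠ Sum.inr v := fun h' ↦ hwc (by rw [Sum.inr_injective h']; exact hvc)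
    have h := hz (Sum.inr w)
    rwa [Function.update_of_ne hwv, selmerF_inr, if_neg hwc] at h
  have h0 : ∀ {z : galoisCohomology ((W.baseChange K).torsionGaloisModule ((2 ^ M : ℕ) : ℤ)) 1},
      (∀ w : Place K, galoisCohomology.localization ((W.baseChange K).torsionGaloisModule ((2 ^ M : ℕ) : ℤ)) w 1 z ∈
        Function.update (selmerF W ((2 ^ M : ℕ) : ℤ) 𝒯 (placesDividing K c)) (Sum.inr v : Place K) ⊤ w) →
      ∀ w : InfinitePlace K,
        galoisCohomology.localization ((W.baseChange K).torsionGaloisModule ((2 ^ M : ℕ) : ℤ)) (Sum.inl w) 1 z ∈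
          (W.baseChange K).kummerSelmerStructure ((2 ^ M : ℕ) : ℤ) (Sum.inl w) := by
    intro z hz w
    have h := hz (Sum.inl w)
    rwa [Function.update_of_ne Sum.inl_ne_inr, selmerF_inl] at h
  exact invWeilPairing_localization_eq_zero_of_hybrid_off W M e hμ hadd₁ hadd₂ hgal halt hnondeg inv hK hD ι hM c
    hc hkol hkM 𝒯 h𝒯 hperf hvan v (hT hx) (hKu hx) (h0 hx) (hT hy) (hKu hy) (h0 hy)

/-! ### §4 The refill law for `𝓕(c)` -/

include hK hD hM hc hkol hkM h𝒯 halt hnondeg hperf hvan hcomp hvc in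
/-- **THE REFILL LAW FOR JETCHEV'S `𝓕(c)` AT `2`.** At a place `v` of the square-free Kolyvagin conductor `c` (indices
`≥ M + 1`), with `X = loc_v(H¹_{𝓕(c)^v})` (a Lagrangian of `H¹(K_v, E[2^M])` by §2–§3): if the Kummer cut is co-cyclic,
`Kum_v = (X ∩ Kum_v) + ℤe₀` (at a REGULAR Kolyvagin prime: the pure-sign cut `(1+h)Kum_v`), then every `t ∈ 𝒯_v`
annihilating `X ∩ Kum_v` has `2t ∈ X` — the refill `X ∩ 𝒯_v = loc_v(H¹_{𝓕(c)})` contains `2 · ann_{𝒯_v}(X ∩ Kum_v)`.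
[cite: MazurRubin2004, Prop. 1.3.2, Thm. 2.3.4, §4.1] [cite: Howard2004HeegnerKolyvagin, Thm. 2.1.11] -/
theorem two_nsmul_mem_map_localization_relaxed_selmerF [NeZero (2 ^ M)]
    [Finite (geomTorsion (W.baseChange K) ((2 ^ M : ℕ) : ℤ))]
    {e₀ : galoisCohomology ((((W.baseChange K).torsionGaloisModule ((2 ^ M : ℕ) : ℤ))).toLocal (Sum.inr v : Place K)) 1}
    (he₀ : e₀ ∈ (W.baseChange K).kummerSelmerStructure ((2 ^ M : ℕ) : ℤ) (Sum.inr v : Place K))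
    (hcyc : ∀ f ∈ (W.baseChange K).kummerSelmerStructure ((2 ^ M : ℕ) : ℤ) (Sum.inr v : Place K), ∃ k : ℤ,
      f - k • e₀ ∈ (SelmerStructure.selmerGroup (Function.update (selmerF W ((2 ^ M : ℕ) : ℤ) 𝒯 (placesDividing K c))
          (Sum.inr v : Place K) ⊤ : SelmerStructure ((W.baseChange K).torsionGaloisModule ((2 ^ M : ℕ) : ℤ)))).map
        (galoisCohomology.localization ((W.baseChange K).torsionGaloisModule ((2 ^ M : ℕ) : ℤ)) (Sum.inr v : Place K) 1))
    {t : galoisCohomology ((((W.baseChange K).torsionGaloisModule ((2 ^ M : ℕ) : ℤ))).toLocal (Sum.inr v : Place K)) 1}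
    (ht : t ∈ 𝒯 (Sum.inr v))
    (hann : ∀ a ∈ (SelmerStructure.selmerGroup (Function.update (selmerF W ((2 ^ M : ℕ) : ℤ) 𝒯 (placesDividing K c))
          (Sum.inr v : Place K) ⊤ : SelmerStructure ((W.baseChange K).torsionGaloisModule ((2 ^ M : ℕ) : ℤ)))).map
        (galoisCohomology.localization ((W.baseChange K).torsionGaloisModule ((2 ^ M : ℕ) : ℤ)) (Sum.inr v : Place K) 1) ⊓
        (W.baseChange K).kummerSelmerStructure ((2 ^ M : ℕ) : ℤ) (Sum.inr v : Place K),
      invWeilPairing (W.baseChange K) (2 ^ M) e hμ hadd₁ hadd₂ hgal inv (Sum.inr v) a t = 0) :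
    2 • t ∈ (SelmerStructure.selmerGroup (Function.update (selmerF W ((2 ^ M : ℕ) : ℤ) 𝒯 (placesDividing K c))
          (Sum.inr v : Place K) ⊤ : SelmerStructure ((W.baseChange K).torsionGaloisModule ((2 ^ M : ℕ) : ℤ)))).map
        (galoisCohomology.localization ((W.baseChange K).torsionGaloisModule ((2 ^ M : ℕ) : ℤ)) (Sum.inr v : Place K) 1) :=
  two_nsmul_mem_of_lagrangian_kolyvaginPlace_two W M e hμ hadd₁ hadd₂ hgal halt hnondeg inv hK hD ι hM c hc hkol hkM 𝒯
    h𝒯 hperf v hvc _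
    (isotropic_map_localization_relaxed_selmerF W M e hμ hadd₁ hadd₂ hgal halt hnondeg inv hK hD ι hM c hc hkol hkM 𝒯
      h𝒯 hperf hvan v hvc)
    (natCard_map_localization_relaxed_selmerF_eq W M e hμ hadd₁ hadd₂ hgal halt hnondeg inv hK hD ι hM c hc hkol hkM
      𝒯 h𝒯 hperf hvan hcomp v hvc)
    he₀ hcyc ht hann

include hμ hadd₁ hadd₂ hgal hK hD hM hc hkol hkM h𝒯 halt hnondeg hperf hvan hcomp hvc in
/-- **THE REFILL LAW FOR `𝓕(c)`, COUNTING FORM: `#Kum_v ≤ 2 · #(X ∩ Kum_v) · #(X ∩ 𝒯_v)`**, `X = loc_v(H¹_{𝓕(c)^v})`,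
under a co-cyclic Kummer cut. At a REGULAR Kolyvagin prime (`#Kum_v = 2^(2M)`) with a pure-sign cut
(`#(X ∩ Kum_v) = 2^M`): `#loc_v(H¹_{𝓕(c)}) ≥ 2^(M−1)`, i.e. the refill exponent is `M − 1` or `M` — the
«2-adic refill law at regular primes» asked for by the S1b reader report (g12), now a theorem.
[cite: MazurRubin2004, Prop. 1.3.2, Thm. 2.3.4, §4.1] [cite: Howard2004HeegnerKolyvagin, Thm. 2.1.11] -/
theorem natCard_kummer_le_two_mul_relaxed_selmerF [NeZero (2 ^ M)]
    [Finite (geomTorsion (W.baseChange K) ((2 ^ M : ℕ) : ℤ))]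
    {e₀ : galoisCohomology ((((W.baseChange K).torsionGaloisModule ((2 ^ M : ℕ) : ℤ))).toLocal (Sum.inr v : Place K)) 1}
    (he₀ : e₀ ∈ (W.baseChange K).kummerSelmerStructure ((2 ^ M : ℕ) : ℤ) (Sum.inr v : Place K))
    (hcyc : ∀ f ∈ (W.baseChange K).kummerSelmerStructure ((2 ^ M : ℕ) : ℤ) (Sum.inr v : Place K), ∃ k : ℤ,
      f - k • e₀ ∈ (SelmerStructure.selmerGroup (Function.update (selmerF W ((2 ^ M : ℕ) : ℤ) 𝒯 (placesDividing K c))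
          (Sum.inr v : Place K) ⊤ : SelmerStructure ((W.baseChange K).torsionGaloisModule ((2 ^ M : ℕ) : ℤ)))).map
        (galoisCohomology.localization ((W.baseChange K).torsionGaloisModule ((2 ^ M : ℕ) : ℤ)) (Sum.inr v : Place K) 1)) :
    Nat.card ((W.baseChange K).kummerSelmerStructure ((2 ^ M : ℕ) : ℤ) (Sum.inr v : Place K)) ≤
      2 * Nat.card ↥((SelmerStructure.selmerGroup (Function.update (selmerF W ((2 ^ M : ℕ) : ℤ) 𝒯 (placesDividing K c))
            (Sum.inr v : Place K) ⊤ : SelmerStructure ((W.baseChange K).torsionGaloisModule ((2 ^ M : ℕ) : ℤ)))).map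
          (galoisCohomology.localization ((W.baseChange K).torsionGaloisModule ((2 ^ M : ℕ) : ℤ)) (Sum.inr v : Place K) 1) ⊓
          (W.baseChange K).kummerSelmerStructure ((2 ^ M : ℕ) : ℤ) (Sum.inr v : Place K)) *
        Nat.card ↥((SelmerStructure.selmerGroup (Function.update (selmerF W ((2 ^ M : ℕ) : ℤ) 𝒯 (placesDividing K c))
            (Sum.inr v : Place K) ⊤ : SelmerStructure ((W.baseChange K).torsionGaloisModule ((2 ^ M : ℕ) : ℤ)))).map
          (galoisCohomology.localization ((W.baseChange K).torsionGaloisModule ((2 ^ M : ℕ) : ℤ)) (Sum.inr v : Place K) 1) ⊓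
          𝒯 (Sum.inr v)) :=
  natCard_kummer_le_two_mul_kolyvaginPlace_two W M e hμ hadd₁ hadd₂ hgal halt hnondeg inv hK hD ι hM c hc hkol hkM 𝒯
    h𝒯 hperf v hvc _
    (isotropic_map_localization_relaxed_selmerF W M e hμ hadd₁ hadd₂ hgal halt hnondeg inv hK hD ι hM c hc hkol hkM 𝒯
      h𝒯 hperf hvan v hvc)
    (natCard_map_localization_relaxed_selmerF_eq W M e hμ hadd₁ hadd₂ hgal halt hnondeg inv hK hD ι hM c hc hkol hkM
      𝒯 h𝒯 hperf hvan hcomp v hvc)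
    he₀ hcyc

/-! ### §5 Walk form for `𝓕(c)`: `#H¹_{𝓕(c)[v ↦ Kum]} · #Kum_v ≤ 2 · #loc_v(H¹_{𝓕(c)[v ↦ Kum]})² · #H¹_{𝓕(c)}` -/

include hμ hadd₁ hadd₂ hgal hK hD hM hc hkol hkM h𝒯 halt hnondeg hperf hvan hcomp hvc in
/-- **WALK FORM OF THE REFILL LAW FOR `𝓕(c)`** (the in-situ `lozenge_refill`). With `𝓛 = 𝓕(c)`, `v ∣ ℓ ∣ c`,
`S = H¹_{𝓛[v ↦ Kum_v]}` (= `H¹_{𝓕(c/ℓ)}` when the transverse families of `c/ℓ` and `c` agree off `ℓ` — the walk's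
previous vertex), `S' = H¹_{𝓛} = H¹_{𝓕(c)}` (the new vertex), and a co-cyclic Kummer cut at `v`:
`#S · #Kum_v ≤ 2 · #loc_v(S)² · #S'`. At a REGULAR `ℓ` with a pure-sign cut (`#Kum_v = 2^(2M)`, `#loc_v(S) = 2^M`):
**`#H¹_{𝓕(c)} ≥ #H¹_{𝓕(c/ℓ)} / 2`** — the step loses at most ONE bit of size (while trading a `(±)`-class of order `2^M`
for a `(∓)`-quotient of order `≥ 2^(M−1)`; see the reader report §3 for the type bookkeeping).
[cite: MazurRubin2004, Prop. 1.3.2, Thm. 2.3.4, §4.1] [cite: Jetchev2008, Lemma 5.2, proof of Prop. 5.3]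
[cite: Howard2004HeegnerKolyvagin, Thm. 2.1.11] -/
theorem lozenge_refill_selmerF [NeZero (2 ^ M)] [Finite (geomTorsion (W.baseChange K) ((2 ^ M : ℕ) : ℤ))]
    {e₀ : galoisCohomology ((((W.baseChange K).torsionGaloisModule ((2 ^ M : ℕ) : ℤ))).toLocal (Sum.inr v : Place K)) 1}
    (he₀ : e₀ ∈ (W.baseChange K).kummerSelmerStructure ((2 ^ M : ℕ) : ℤ) (Sum.inr v : Place K))
    (hcyc : ∀ f ∈ (W.baseChange K).kummerSelmerStructure ((2 ^ M : ℕ) : ℤ) (Sum.inr v : Place K), ∃ k : ℤ,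
      f - k • e₀ ∈ (SelmerStructure.selmerGroup (Function.update (selmerF W ((2 ^ M : ℕ) : ℤ) 𝒯 (placesDividing K c))
          (Sum.inr v : Place K) ⊤ : SelmerStructure ((W.baseChange K).torsionGaloisModule ((2 ^ M : ℕ) : ℤ)))).map
        (galoisCohomology.localization ((W.baseChange K).torsionGaloisModule ((2 ^ M : ℕ) : ℤ)) (Sum.inr v : Place K) 1)) :
    Nat.card (SelmerStructure.selmerGroup (Function.update (selmerF W ((2 ^ M : ℕ) : ℤ) 𝒯 (placesDividing K c))
          (Sum.inr v : Place K) ((W.baseChange K).kummerSelmerStructure ((2 ^ M : ℕ) : ℤ) (Sum.inr v : Place K)) :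
          SelmerStructure ((W.baseChange K).torsionGaloisModule ((2 ^ M : ℕ) : ℤ)))) *
        Nat.card ((W.baseChange K).kummerSelmerStructure ((2 ^ M : ℕ) : ℤ) (Sum.inr v : Place K)) ≤
      2 * Nat.card ((SelmerStructure.selmerGroup (Function.update (selmerF W ((2 ^ M : ℕ) : ℤ) 𝒯 (placesDividing K c))
            (Sum.inr v : Place K) ((W.baseChange K).kummerSelmerStructure ((2 ^ M : ℕ) : ℤ) (Sum.inr v : Place K)) :
            SelmerStructure ((W.baseChange K).torsionGaloisModule ((2 ^ M : ℕ) : ℤ)))).map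
          (galoisCohomology.localization ((W.baseChange K).torsionGaloisModule ((2 ^ M : ℕ) : ℤ))
            (Sum.inr v : Place K) 1)) ^ 2 *
        Nat.card (selmerF W ((2 ^ M : ℕ) : ℤ) 𝒯 (placesDividing K c)).selmerGroup := by
  haveI : Finite (galoisCohomology ((((W.baseChange K).torsionGaloisModule ((2 ^ M : ℕ) : ℤ))).toLocal
      (Sum.inr v : Place K)) 1) := finite_galoisCohomology_one_toLocal _ v
  have hinv : Injective (inv (Sum.inr v)) := (hperf v).1.1
  set 𝓛 := selmerF W ((2 ^ M : ℕ) : ℤ) 𝒯 (placesDividing K c) with h𝓛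
  set loc := galoisCohomology.localization ((W.baseChange K).torsionGaloisModule ((2 ^ M : ℕ) : ℤ))
    (Sum.inr v : Place K) 1 with hloc
  set Rel := SelmerStructure.selmerGroup (Function.update 𝓛 (Sum.inr v : Place K) ⊤ :
    SelmerStructure ((W.baseChange K).torsionGaloisModule ((2 ^ M : ℕ) : ℤ))) with hRel
  -- `S = Rel ⊓ loc⁻¹ Kum_v`, `S' = 𝓛.selmerGroup = Rel ⊓ loc⁻¹ 𝒯_v`
  have hS : SelmerStructure.selmerGroup (Function.update 𝓛 (Sum.inr v : Place K)
        ((W.baseChange K).kummerSelmerStructure ((2 ^ M : ℕ) : ℤ) (Sum.inr v : Place K)) :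
        SelmerStructure ((W.baseChange K).torsionGaloisModule ((2 ^ M : ℕ) : ℤ))) =
      Rel ⊓ ((W.baseChange K).kummerSelmerStructure ((2 ^ M : ℕ) : ℤ) (Sum.inr v : Place K)).comap loc :=
    selmerGroup_update_eq_inf_comap W M 𝓛 v _
  have h𝓛v : 𝓛 (Sum.inr v) = 𝒯 (Sum.inr v) := by rw [h𝓛, selmerF_inr, if_pos hvc]
  have hS' : 𝓛.selmerGroup = Rel ⊓ (𝒯 (Sum.inr v)).comap loc := by
    have h := selmerGroup_update_eq_inf_comap W M 𝓛 v (𝒯 (Sum.inr v))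
    have hupd : Function.update 𝓛 (Sum.inr v : Place K) (𝒯 (Sum.inr v)) = 𝓛 := by
      rw [← h𝓛v, Function.update_eq_self]
    rw [hupd] at h
    exact h
  rw [hS, hS']
  exact lozenge_refill
    (invWeilPairing (W.baseChange K) (2 ^ M) e hμ hadd₁ hadd₂ hgal inv (Sum.inr v))
    (X11b.KummerPT.nsmul_galoisCohomology_toLocal_eq_zero (W.baseChange K) (2 ^ M) (Sum.inr v))
    (fun x y ↦ AdditiveKoly.LagrangianSwitchAtP.invWeilPairing_symm (W.baseChange K) (2 ^ M) e hμ hadd₁ hadd₂ hgal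
      halt inv (Sum.inr v) x y)
    (kummer_inf_transverse_eq_bot_two W M hK hD ι hM c hc hkol hkM 𝒯 h𝒯 v hvc)
    (kummer_sup_transverse_eq_top_two W M hK hD ι hM c hc hkol hkM 𝒯 h𝒯 v hvc)
    (fun x hx y hy ↦ invWeilPairing_eq_zero_of_mem (W.baseChange K) (2 ^ M) e hμ hadd₁ hadd₂ hgal halt inv
      (Sum.inr v) hx hy)
    (fun x hx y hy ↦ transverse_isotropic_two W M e hμ hadd₁ hadd₂ hgal halt hnondeg inv hK hD ι hM c hc hkol hkM 𝒯
      h𝒯 hperf v hvc hx hy)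
    (invWeilPairing_injective_of_symm W M e hμ hadd₁ hadd₂ hgal halt hnondeg inv v hinv) loc Rel
    (isotropic_map_localization_relaxed_selmerF W M e hμ hadd₁ hadd₂ hgal halt hnondeg inv hK hD ι hM c hc hkol hkM 𝒯
      h𝒯 hperf hvan v hvc)
    (natCard_map_localization_relaxed_selmerF_eq W M e hμ hadd₁ hadd₂ hgal halt hnondeg inv hK hD ι hM c hc hkol hkM
      𝒯 h𝒯 hperf hvan hcomp v hvc)
    he₀ hcyc

end Summit.BirchSwinnertonDyer.BirchSwinnertonDyer.Theorems.KolyvaginAtTwo.RegularRefill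

end
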